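import Summits.ResolutionOfSingularities.ResolutionOfSingularities.Theorems.WeightedInvariantWeightedConstructionLexmaxHullDefs
import Summits.ResolutionOfSingularities.ResolutionOfSingularities.Theorems.WeightedInvariantWeightedConstructionPlexComapChartIdeal
import Summits.ResolutionOfSingularities.ResolutionOfSingularities.Theorems.WeightedInvariantWeightedConstructionPlexComapStalk

/-!
# B2′ ⊇: admissible profiles pull back along smooth morphisms (line `pointwise-lexmax-hull`)

Route `ResolutionOfSingularities/WeightedInvariant`, crux `WeightedConstruction`
(stmt-ResolutionOfSingularities-0571), line `pointwise-lexmax-hull`, stub `stub_plexComap` (B2′ of the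
split of `stub_hullUsc`). [OURS · L1 W4.3] The ⊇-half of (B2′), modulo formal smoothness of the
residue field at the image point (automatic at closed points over a perfect field):

* `admissibleProfileAt_comap_of_smooth` — for `f : Y → Spec k`, `g : Y₁ → Y` smooth and a point `y₁`
  with `κ(g y₁)` formally smooth over `k`, every profile admissible for `X` at `g y₁`
  (`PointwiseLexmaxHull.AdmissibleProfileAt`, `Theorems/…LexmaxHullDefs.lean`) is admissible for
  `X.comap g` at `y₁`: the chart `(U, u, w, d)` pulls back to `(U₁, g^*u, w, d)` on an affine
  `U₁ ∋ y₁` inside `g⁻¹U` — parameters stay part of a regular system of parameters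
  (`linearIndependent_toCotangent_stalkMap_of_smooth`), the ideal condition pulls back
  (`comap_ideal_le_weightedMonomialIdeal`), the profile is unchanged.
* `plex_le_plex_comap_of_smooth` — hence, for every rule `R : LexmaxHullRule p`, at a CLOSED point `y₁`
  with `g y₁` closed and `X` singular there: `R.plex f X (g y₁) ≤ R.plex f₁ (X.comap g) y₁`
  (`plex` is the greatest admissible profile). The reverse inequality is the content of (B2′).

No new mathematics; NOT a statement of the manuscript under review.
-/

noncomputable section

set_option linter.dupNamespace false -- mandated namespace of this single-conjunct summit

open CategoryTheory CategoryTheory.Limits AlgebraicGeometry TopologicalSpace IsLocalRing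
open Literature.AlgebraicGeometry.Resolution

namespace Summit.ResolutionOfSingularities.ResolutionOfSingularities.Theorems.PointwiseLexmaxHull

/-- **Admissible profiles pull back along smooth morphisms.** See the module docstring. [folklore] -/
theorem admissibleProfileAt_comap_of_smooth ⦃k : Type⦄ [Field k] ⦃Y Y₁ : Scheme.{0}⦄
    (f : Y ⟶ Spec (.of k)) [Smooth f] (g : Y₁ ⟶ Y) [Smooth g] (X : Y.IdealSheafData) (y₁ : Y₁)
    (hκ : letI := stalkAlgebra (f.appTop.hom.comp (Scheme.ΓSpecIso (.of k)).inv.hom) (g y₁)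
      Algebra.FormallySmooth k (ResidueField (Y.presheaf.stalk (g y₁))))
    (π : Profile) (h : AdmissibleProfileAt X (g y₁) π) : AdmissibleProfileAt (X.comap g) y₁ π := by
  obtain ⟨U, hy, m, u, w, d, hw, hanti, hd, ⟨hmax, hli⟩, hX, hπ⟩ := h
  -- an affine open `U₁ ∋ y₁` inside `g⁻¹ U`
  obtain ⟨_, ⟨U₁, hU₁, rfl⟩, hy₁, hU₁le⟩ := Y₁.isBasis_affineOpens.exists_subset_of_mem_open
    (show y₁ ∈ ((g ⁻¹ᵁ (U : Y.Opens) : Y₁.Opens) : Set Y₁) from hy) (g ⁻¹ᵁ (U : Y.Opens)).isOpen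
  have hle : U₁ ≤ g ⁻¹ᵁ (U : Y.Opens) := hU₁le
  -- germs of the pulled-back sections are the images of the germs under the stalk map
  have heq : g.appLE U U₁ hle ≫ Y₁.presheaf.germ U₁ y₁ hy₁ =
      Y.presheaf.germ (U : Y.Opens) (g y₁) hy ≫ g.stalkMap y₁ := by
    rw [Scheme.Hom.germ_stalkMap, Scheme.Hom.appLE, Category.assoc, TopCat.Presheaf.germ_res]
  have hgerm : ∀ i, (Y₁.presheaf.germ U₁ y₁ hy₁).hom ((g.appLE U U₁ hle).hom (u i)) =
      (g.stalkMap y₁).hom ((Y.presheaf.germ (U : Y.Opens) (g y₁) hy).hom (u i)) := by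
    intro i
    have := congrArg (fun φ => φ.hom (u i)) heq
    simpa only [CommRingCat.hom_comp, RingHom.comp_apply] using this
  have hmem : ∀ i, (Y₁.presheaf.germ U₁ y₁ hy₁).hom ((g.appLE U U₁ hle).hom (u i)) ∈
      maximalIdeal (Y₁.presheaf.stalk y₁) := fun i => by
    rw [hgerm i]
    exact map_nonunit (g.stalkMap y₁).hom _ (hmax i)
  have hli₁ := linearIndependent_toCotangent_stalkMap_of_smooth f g y₁ hκ
    (fun i => (Y.presheaf.germ (U : Y.Opens) (g y₁) hy).hom (u i)) hmax hli
  have hfam : (fun i => (maximalIdeal (Y₁.presheaf.stalk y₁)).toCotangent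
      ⟨(g.stalkMap y₁).hom ((Y.presheaf.germ (U : Y.Opens) (g y₁) hy).hom (u i)),
        map_nonunit (g.stalkMap y₁).hom _ (hmax i)⟩) =
      fun i => (maximalIdeal (Y₁.presheaf.stalk y₁)).toCotangent
        ⟨(Y₁.presheaf.germ U₁ y₁ hy₁).hom ((g.appLE U U₁ hle).hom (u i)), hmem i⟩ := by
    funext i
    congr 1
    exact Subtype.ext (hgerm i).symm
  rw [hfam] at hli₁
  exact ⟨⟨U₁, hU₁⟩, hy₁, m, fun i => (g.appLE U U₁ hle).hom (u i), w, d, hw, hanti, hd,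
    ⟨hmem, hli₁⟩, comap_ideal_le_weightedMonomialIdeal g X U ⟨U₁, hU₁⟩ hle u w d hX, hπ⟩

/-- **`plex` does not decrease under smooth pull-back.** For a rule `R : LexmaxHullRule p` (perfect
ground field of characteristic `p`; `f`, `f₁` smooth separated quasi-compact; `g` smooth with
`g ≫ f = f₁`), a CLOSED point `y₁` with `g y₁` closed, `X` singular at `g y₁`, and `κ(g y₁)` formally
smooth over `k`: `R.plex f X (g y₁) ≤ R.plex f₁ (X.comap g) y₁` — `plex` is the greatest admissible
profile (`plex_isGreatest`) and admissible profiles pull back (`admissibleProfileAt_comap_of_smooth`,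
`xSing_comap_iff_of_smooth`). [folklore] -/
theorem plex_le_plex_comap_of_smooth {p : ℕ} (R : LexmaxHullRule p) ⦃k : Type⦄ [Field k]
    [CharP k p] [PerfectField k] ⦃Y Y₁ : Scheme.{0}⦄
    (f : Y ⟶ Spec (.of k)) [Smooth f] [IsSeparated f] [QuasiCompact f]
    (f₁ : Y₁ ⟶ Spec (.of k)) [Smooth f₁] [IsSeparated f₁] [QuasiCompact f₁]
    (g : Y₁ ⟶ Y) [Smooth g] (hg : g ≫ f = f₁) (X : Y.IdealSheafData) (y₁ : Y₁)
    (hy₁ : IsClosed ({y₁} : Set Y₁)) (hgy₁ : IsClosed ({g y₁} : Set Y)) (hX : XSing X (g y₁))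
    (hκ : letI := stalkAlgebra (f.appTop.hom.comp (Scheme.ΓSpecIso (.of k)).inv.hom) (g y₁)
      Algebra.FormallySmooth k (ResidueField (Y.presheaf.stalk (g y₁)))) :
    R.plex f X (g y₁) ≤ R.plex f₁ (X.comap g) y₁ := by
  have hX₁ : XSing (X.comap g) y₁ := (xSing_comap_iff_of_smooth f f₁ g hg X y₁).mpr hX
  exact (R.plex_isGreatest f X (g y₁) hgy₁ hX).mono (R.plex_isGreatest f₁ (X.comap g) y₁ hy₁ hX₁)
    fun π hπ => admissibleProfileAt_comap_of_smooth f g X y₁ hκ π hπ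

end Summit.ResolutionOfSingularities.ResolutionOfSingularities.Theorems.PointwiseLexmaxHull

end
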